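/-
Copyright (c) 2026. All rights reserved.
Released under Apache 2.0 license as described in the file LICENSE.
Authors: abc-iut cell, seat abc-iut-f-081 (F fact-proving wave; follow-up to FACT-LIST row F-0360).
-/
import Literature.AnabelianGeometry.AbsoluteAnabelian.AbsTopIII.FrobeniusPictureMLFCompatNecessity
import HarnessLib

/-!
# [AbsTopIII] Cor. 3.6 (iii), second clause, TELECORE half read literally: a common family of `𝒥` and
# `𝔖_log` also forces the Galois components of `ι_×`, `ι_{log,⋎}` to be ISOMORPHISMS

S. Mochizuki, *Topics in Absolute Anabelian Geometry III* [MochizukiAbsTopIII2015] (kurims manuscript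
`paper:url-5493eb38cbb7`): Cor. 3.6 (iii) p. 80 ("compatible with the families of homotopies that
constitute the core and telecore structures of (i), (ii)"), proof p. 81 l. 21–26; Def. 3.5 (ii), (iv)
pp. 75–76 (families of homotopies; the telecore family `𝒥`, whose boundary set is symmetric).

PROOF-ONLY continuation (no notion is declared) of `FrobeniusPictureMLFCompatNecessity.lean` (seat
abc-iut-f-081), which proved the NECESSITY statement for the CORES half `LogObsCompatCoresStmt` of the
literal compatibility clause (abc-iut-L4-t5, `FrobeniusPictureMLFCompatibility.lean`).  Here the same is
proved for the TELECORE half `LogObsCompatTelecoreStmt τ`: one family `K` on the telecore diagram `𝒟_An`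
containing the telecore family `𝒥` and (along `𝒟_{≤3} ↪ 𝒟_An`) the `𝔖_log` family.

* `DiagramOfCategories.HomotopyFamily.η_app_postcomp_path` / `isIso_map_of_postcomp_path` — Def. 3.5 (ii)
  (b) for post-composition with a PATH (the one-edge case is `η_app_postcomp_edge`): the homotopy of
  `(p·r, q·r)` has components `𝒟_[r](θ_x)`; if it is an isomorphism, so is every `𝒟_[r](θ_x)`.
* `LogFrobeniusData.isIso_NtoE_map_iotaTimes_of_logObsCompatTelecoreStmt`,
  `LogFrobeniusData.isIso_NtoE_map_iotaLog_of_logObsCompatTelecoreStmt` — **NECESSITY, telecore half**: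
  the `𝔖_log` pairs post-composed with `[𝒩 → ℰ]·[κ_An]` are pairs INTO THE CORE VERTEX `Anab`, hence
  boundary pairs of `𝒥` (Def. 3.5 (iv) (b), with `[γ₃] = []`), in both orders; so the common family's
  homotopy there is an isomorphism, i.e. `κ_An((𝒩 → ℰ)(ι_x))` is — and `κ_An` is an equivalence.
* `LogFrobeniusData.exists_not_logObsCompatTelecoreStmt` / `not_forall_logObsCompatTelecoreStmt` — at the
  one-object `(ℕ, +)` datum (`ι_× := 1` not invertible) the telecore half FAILS for the printed-shape
  telecore datum `⟨𝟭, unitor, unitors⟩`: it is not a consequence of the typing either.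

With the cores half this settles: BOTH halves of the literal clause force invertible Galois components;
the typed content F-0360 (`IotaOverGaloisStmt`: identities) implies that condition.  HONEST FRAMING:
category-theoretic bookkeeping over the typed data and a toy datum; refereed pre-IUT material; nothing
here bears on [IUTchIII] Cor. 3.12 or takes a side; typed ≠ proved.
-/

namespace Literature.AnabelianGeometry.AbsoluteAnabelian

open _root_.CategoryTheory _root_.Quiver

universe u

/-! ### `eqToHom` / `HEq` bookkeeping -/

section Bookkeeping

universe v₁ v₂ u₁ u₂

/-- Components of a natural transformation at propositionally equal objects. [folklore] -/
private theorem app_eq_of_obj_eq₃ {C : Type u₁} [Category.{v₁} C] {C' : Type u₂} [Category.{v₂} C']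
    {F G : C ⥤ C'} (θ : F ⟶ G) {X Y : C} (h : X = Y) :
    θ.app X = eqToHom (by rw [h]) ≫ θ.app Y ≫ eqToHom (by rw [h]) := by
  subst h
  simp

/-- Components of heterogeneously equal natural transformations between equal functors. [folklore] -/
private theorem app_eq_of_heq₃ {C : Type u₁} [Category.{v₁} C] {C' : Type u₂} [Category.{v₂} C']
    {F G F' G' : C ⥤ C'} (hF : F = F') (hG : G = G') {α : F ⟶ G} {β : F' ⟶ G'} (h : HEq α β)
    (X : C) :
    β.app X = eqToHom (Functor.congr_obj hF X).symm ≫ α.app X ≫ eqToHom (Functor.congr_obj hG X) := by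
  subst hF hG
  simp [eq_of_heq h]

/-- An isomorphism stays an isomorphism across a heterogeneous equality of natural transformations
between equal functors. [folklore] -/
private theorem isIso_of_heq₃ {C : Type u₁} [Category.{v₁} C] {C' : Type u₂} [Category.{v₂} C']
    {F G F' G' : C ⥤ C'} (hF : F = F') (hG : G = G') {α : F ⟶ G} {β : F' ⟶ G'} (h : HEq α β)
    (hα : IsIso α) : IsIso β := by
  subst hF hG
  rw [← eq_of_heq h]
  exact hα

/-- Transport of `IsIso (F.map f)` along an equality of functors. [folklore] -/
private theorem isIso_map_of_eq₃ {C : Type u₁} [Category.{v₁} C] {C' : Type u₂} [Category.{v₂} C']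
    {F G : C ⥤ C'} (h : F = G) {a b : C} {f : a ⟶ b} (hf : IsIso (F.map f)) : IsIso (G.map f) := by
  subst h
  exact hf

/-- Merging the `eqToHom`s of a singly nested conjugate. [folklore] -/
private theorem eqToHom_sandwich₃ {C : Type u₁} [Category.{v₁} C] {A B₁ B₂ C₁ C₂ E : C} (p : A = B₁)
    (q : B₁ = B₂) (m : B₂ ⟶ C₁) (r : C₁ = C₂) (s : C₂ = E) :
    eqToHom p ≫ (eqToHom q ≫ m ≫ eqToHom r) ≫ eqToHom s =
      eqToHom (p.trans q) ≫ m ≫ eqToHom (r.trans s) := by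
  cases p; cases q; cases r; cases s; simp

/-- Stripping `eqToHom`s from an isomorphism. [folklore] -/
private theorem isIso_of_isIso_eqToHom_sandwich₃ {C : Type u₁} [Category.{v₁} C] {a a' b b' : C}
    (p : a = a') (f : a' ⟶ b') (q : b' = b) (h : IsIso (eqToHom p ≫ f ≫ eqToHom q)) : IsIso f := by
  subst p q
  simpa using h

end Bookkeeping

/-! ### Def. 3.5 (ii): post-composition with a path -/

namespace DiagramOfCategories.HomotopyFamily

universe v' u' w'

variable {V : Type w'} [Quiver.{v'} V] {D : DiagramOfCategories.{v', u', w'} V} (K : D.HomotopyFamily)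

/-- **Def. 3.5 (ii) (b), post-composition with a path, componentwise.**  If `(p, q) ∈ E_K` has homotopy
components `θ_x` (through `eqToHom`s) and `(p·r, q·r) ∈ E_K` for a path `r`, then the homotopy of the
latter pair has components `𝒟_[r](θ_x)` (through `eqToHom`s).
[cite: MochizukiAbsTopIII2015, Definition 3.5 (ii) p.75] -/
theorem η_app_postcomp_path {a ob tg : V} {p q : Path a ob} (r : Path ob tg)
    {P Q : D.obj a → D.obj ob} (θ : ∀ x, P x ⟶ Q x) (hT : K.E p q)
    (hP : ∀ x, (D.pathFunctor p).obj x = P x) (hQ : ∀ x, (D.pathFunctor q).obj x = Q x)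
    (hhT : ∀ (x : D.obj a) (e₁ : (D.pathFunctor p).obj x = P x) (e₂ : (D.pathFunctor q).obj x = Q x),
      (K.η hT).app x = eqToHom e₁ ≫ θ x ≫ eqToHom e₂.symm)
    (hE : K.E (p.comp r) (q.comp r)) (x : D.obj a) :
    (K.η hE).app x =
      eqToHom ((Functor.congr_obj (D.pathFunctor_comp p r) x).trans
          (congrArg (D.pathFunctor r).obj (hP x))) ≫
        (D.pathFunctor r).map (θ x) ≫
      eqToHom ((Functor.congr_obj (D.pathFunctor_comp q r) x).trans
        (congrArg (D.pathFunctor r).obj (hQ x))).symm := by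
  -- the whiskering axiom, for `r₁ = []`, `r₂ = r`
  have W := K.η_whisker hT (Path.nil : Path a a) r
  have hp : (Path.nil : Path a a).comp (p.comp r) = p.comp r := Path.nil_comp _
  have hq : (Path.nil : Path a a).comp (q.comp r) = q.comp r := Path.nil_comp _
  have Hη := K.η_heq_of_eq hp hq (K.isSaturated.precomp (K.isSaturated.postcomp hT r) Path.nil) hE
  have EF : D.pathFunctor ((Path.nil : Path a a).comp (p.comp r)) = D.pathFunctor (p.comp r) := by rw [hp]
  have EG : D.pathFunctor ((Path.nil : Path a a).comp (q.comp r)) = D.pathFunctor (q.comp r) := by rw [hq]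
  rw [app_eq_of_heq₃ EF EG Hη x, NatTrans.congr_app W x]
  have E0 : D.pathFunctor (Path.nil : Path a a) = 𝟭 _ := D.pathFunctor_nil a
  have hx0 : (D.pathFunctor (Path.nil : Path a a)).obj x = x := Functor.congr_obj E0 x
  simp only [NatTrans.comp_app, eqToHom_app, Functor.whiskerLeft_app, Functor.whiskerRight_app,
    app_eq_of_obj_eq₃ (K.η hT) hx0, hhT x (hP x) (hQ x), Functor.map_comp, eqToHom_map,
    Category.assoc, eqToHom_trans, eqToHom_trans_assoc]
  exact eqToHom_sandwich₃ _ _ _ _ _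

/-- **If the post-composed homotopy is an isomorphism, so is every `𝒟_[r](θ_x)`.**
[cite: MochizukiAbsTopIII2015, Definition 3.5 (ii) p.75] -/
theorem isIso_map_of_postcomp_path {a ob tg : V} {p q : Path a ob} (r : Path ob tg)
    {P Q : D.obj a → D.obj ob} (θ : ∀ x, P x ⟶ Q x) (hT : K.E p q)
    (hP : ∀ x, (D.pathFunctor p).obj x = P x) (hQ : ∀ x, (D.pathFunctor q).obj x = Q x)
    (hhT : ∀ (x : D.obj a) (e₁ : (D.pathFunctor p).obj x = P x) (e₂ : (D.pathFunctor q).obj x = Q x),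
      (K.η hT).app x = eqToHom e₁ ≫ θ x ≫ eqToHom e₂.symm)
    (hE : K.E (p.comp r) (q.comp r)) (hiso : IsIso (K.η hE)) (x : D.obj a) :
    IsIso ((D.pathFunctor r).map (θ x)) := by
  haveI := hiso
  have hc : IsIso ((K.η hE).app x) := inferInstance
  rw [K.η_app_postcomp_path r θ hT hP hQ hhT hE x] at hc
  exact isIso_of_isIso_eqToHom_sandwich₃ _ _ _ hc

end DiagramOfCategories.HomotopyFamily

/-! ### Necessity, telecore half -/

namespace LogFrobeniusData

open DiagramOfCategories

variable (Δ : LogFrobeniusData.{u})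

section Telecore

variable {J : SubVertex {a : LFVertex | a.row ≤ 4} → Type u}
  {telMap : ∀ {a}, J a → (Δ.A ⥤ (Δ.sub 4).obj a)}

/-- Object equalities of the type-(2) `𝔖_log` pair read in a telecore diagram `𝒟_An` (along
`embLogTele`). [cite: MochizukiAbsTopIII2015, Corollary 3.6 (iii) p.81] -/
theorem tele_timesPair_obj (x : Δ.X) :
    ((Δ.teleDiagram J telMap).pathFunctor
        ((embLogTele J).mapPath ((Path.nil : Path lvNexus.{u} lvNexus).cons eLamTimes))).obj x =
        Δ.lamTimes.obj x ∧
      ((Δ.teleDiagram J telMap).pathFunctor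
        ((embLogTele J).mapPath ((Path.nil : Path lvNexus.{u} lvNexus).cons eLamPf))).obj x =
        Δ.lamPf.obj x := by
  constructor <;>
    simp only [Prefunctor.mapPath_cons, Prefunctor.mapPath_nil, pathFunctor_cons, pathFunctor_nil] <;> rfl

/-- Object equalities of the type-(1) `𝔖_log` pair read in a telecore diagram `𝒟_An`.
[cite: MochizukiAbsTopIII2015, Corollary 3.6 (iii) p.81] -/
theorem tele_logPair_obj (n : ℤ) (x : Δ.X₁) :
    ((Δ.teleDiagram J telMap).pathFunctor ((embLogTele J).mapPath (logPairLeft.{u} n))).obj x =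
        Δ.lamTimes.obj (Δ.toNexus.obj (Δ.log.obj x)) ∧
      ((Δ.teleDiagram J telMap).pathFunctor ((embLogTele J).mapPath (logPairRight.{u} n))).obj x =
        Δ.lamPf.obj (Δ.toNexus.obj x) := by
  constructor <;>
    simp only [logPairLeft, logPairRight, Prefunctor.mapPath_cons, Prefunctor.mapPath_nil,
      pathFunctor_cons, pathFunctor_nil] <;> rfl

/-- The functor along `[𝒩 → ℰ]·[κ_An]` of a telecore diagram is `(𝒩 → ℰ) ⋙ κ_An` (equation lemmas of
`pathFunctor`). [cite: MochizukiAbsTopIII2015, Corollary 3.6 (ii) p.79] -/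
theorem tele_pathFunctor_toCore :
    (Δ.teleDiagram J telMap).pathFunctor
        (((Path.nil : Path (tvThird J) (tvThird J)).cons
          (show tvThird J ⟶ tvFourth J from LFVertex.edge34)).cons
          (show tvFourth J ⟶ tvObs J from (PUnit.unit : coreI5.{u} (vx 4 .fourth (by decide))))) =
      (𝟭 _ ⋙ Δ.NtoE) ⋙ Δ.κ := by
  rw [pathFunctor_cons, pathFunctor_cons, pathFunctor_nil]
  rfl

end Telecore

/-- In a common family `K` of `𝒥` (Def. 3.5 (iv)) on `𝒟_An`, the homotopy on any pair of paths INTO THE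
CORE VERTEX `Anab` is an ISOMORPHISM: both orders are boundary pairs of `𝒥` (`[γ₃] = []`), whose homotopies
are then mutually inverse. [cite: MochizukiAbsTopIII2015, Definition 3.5 (iv) p.76] -/
theorem isIso_η_of_jfam_compatible {H : Δ.core5Diagram.HomotopyFamily}
    {hH : ∀ ⦃a b : coreShape5.{u}.Vertex⦄ ⦃p q : Path a b⦄, H.E p q → b = coreShape5.{u}.obs}
    {hc : (Δ.coreObs5 H hH).IsCore} (T : (Δ.sub 4).Telecore (Δ.coreObs5 H hH) hc)
    (K : (Δ.teleDiagram T.J T.telMap).HomotopyFamily) (hJ : T.Jfam.CompatibleAlong (𝟭q _) K)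
    {a : (teleShape T.J).Vertex} (P Q : Path a (tvObs T.J))
    (hE : K.E ((𝟭q _).mapPath P) ((𝟭q _).mapPath Q)) : IsIso (K.η hE) := by
  have hb : T.Jfam.E P Q := (T.boundary_iff P Q).mpr ⟨P, Q, Path.nil, rfl, rfl⟩
  have hb' : T.Jfam.E Q P := (T.boundary_iff Q P).mpr ⟨Q, P, Path.nil, rfl, rfl⟩
  have hisoJ : IsIso (T.Jfam.η hb) :=
    ⟨T.Jfam.η hb', by rw [← T.Jfam.η_trans hb hb', T.Jfam.η_refl],
      by rw [← T.Jfam.η_trans hb' hb, T.Jfam.η_refl]⟩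
  obtain ⟨hE', hheq⟩ := hJ P Q hb
  have hF : (Δ.teleDiagram T.J T.telMap).pathFunctor P =
      (Δ.teleDiagram T.J T.telMap).pathFunctor ((𝟭q _).mapPath P) :=
    congrArg _ (Prefunctor.mapPath_id P).symm
  have hG : (Δ.teleDiagram T.J T.telMap).pathFunctor Q =
      (Δ.teleDiagram T.J T.telMap).pathFunctor ((𝟭q _).mapPath Q) :=
    congrArg _ (Prefunctor.mapPath_id Q).symm
  exact isIso_of_heq₃ hF hG hheq hisoJ

/-- **Necessity (telecore half), `ι_×`**: if the telecore half of the literal compatibility clause of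
Cor. 3.6 (iii) holds (`LogObsCompatTelecoreStmt τ`: one family on `𝒟_An` contains `𝒥` and the `𝔖_log`
family), then after `𝒩 → ℰ` every component of `ι_×` is an ISOMORPHISM of `ℰ`: `([λ^×], [λ^{×pf}])`
post-composed with `[𝒩 → ℰ]·[κ_An]` is a pair into the core vertex `Anab`, so the common homotopy
`κ_An((𝒩 → ℰ)(ι_{×,x}))` is an isomorphism, and `κ_An` is an equivalence.
[cite: MochizukiAbsTopIII2015, Corollary 3.6 (iii) pp.80–81] -/
theorem isIso_NtoE_map_iotaTimes_of_logObsCompatTelecoreStmt (τ : Δ.TelecoreData)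
    (h : Δ.LogObsCompatTelecoreStmt τ) :
    match Δ.ιtimes with
    | .inl ι => ∀ x : Δ.X, IsIso (Δ.NtoE.map (ι.app x))
    | .inr ι => ∀ x : Δ.X, IsIso (Δ.NtoE.map (ι.app x)) := by
  obtain ⟨H₅, hH₅, hc, T, -, K, hJ, H₃, ⟨-, -, hpin⟩, hc₃⟩ := h
  obtain ⟨htimes, -⟩ := hpin
  haveI := Δ.κ_equiv
  -- the path `[𝒩 → ℰ]·[κ_An]` of `𝒟_An`
  let r : Path (tvThird T.J) (tvObs T.J) :=
    ((Path.nil : Path (tvThird T.J) (tvThird T.J)).cons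
      (show tvThird T.J ⟶ tvFourth T.J from LFVertex.edge34)).cons
      (show tvFourth T.J ⟶ tvObs T.J from (PUnit.unit : coreI5.{u} (vx 4 .fourth (by decide))))
  have Er : (Δ.teleDiagram T.J T.telMap).pathFunctor r = (𝟭 _ ⋙ Δ.NtoE) ⋙ Δ.κ :=
    Δ.tele_pathFunctor_toCore (J := T.J) (telMap := T.telMap)
  -- the functor identifications along `embLogTele` for the two type-(2) paths
  have hFT : Δ.sub3.pathFunctor ((Path.nil : Path lvNexus.{u} lvNexus).cons eLamTimes) =
      (Δ.teleDiagram T.J T.telMap).pathFunctor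
        ((embLogTele T.J).mapPath ((Path.nil : Path lvNexus.{u} lvNexus).cons eLamTimes)) :=
    eq_of_heq (Δ.heq_pathFunctor_embLogTele T.J T.telMap _)
  have hFP : Δ.sub3.pathFunctor ((Path.nil : Path lvNexus.{u} lvNexus).cons eLamPf) =
      (Δ.teleDiagram T.J T.telMap).pathFunctor
        ((embLogTele T.J).mapPath ((Path.nil : Path lvNexus.{u} lvNexus).cons eLamPf)) :=
    eq_of_heq (Δ.heq_pathFunctor_embLogTele T.J T.telMap _)
  revert htimes
  rcases hι : Δ.ιtimes with ι | ι <;> intro htimes <;> obtain ⟨hT, hhT⟩ := htimes <;> intro x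
  · obtain ⟨hT', hheq⟩ := hc₃ _ _ hT
    have hE : K.E
        ((𝟭q _).mapPath ((((Path.nil : Path (tvNexus T.J) (tvNexus T.J)).cons
          (show tvNexus T.J ⟶ tvThird T.J from LFVertex.lamTimesEdge)).comp r)))
        ((𝟭q _).mapPath ((((Path.nil : Path (tvNexus T.J) (tvNexus T.J)).cons
          (show tvNexus T.J ⟶ tvThird T.J from LFVertex.lamPfEdge)).comp r))) :=
      K.isSaturated.postcomp hT' r
    have hiso := Δ.isIso_η_of_jfam_compatible T K hJ _ _ hE
    have key := K.isIso_map_of_postcomp_path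
      (p := (embLogTele T.J).mapPath ((Path.nil : Path lvNexus.{u} lvNexus).cons eLamTimes))
      (q := (embLogTele T.J).mapPath ((Path.nil : Path lvNexus.{u} lvNexus).cons eLamPf)) r
      (P := fun x => Δ.lamTimes.obj x) (Q := fun x => Δ.lamPf.obj x) (fun x => ι.app x) hT'
      (fun x => (Δ.tele_timesPair_obj x).1) (fun x => (Δ.tele_timesPair_obj x).2)
      (fun x e₁ e₂ => by
        rw [app_eq_of_heq₃ hFT hFP hheq x, hhT x (Δ.timesPair_obj x).1 (Δ.timesPair_obj x).2]
        exact eqToHom_sandwich₃ _ _ _ _ _)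
      hE hiso x
    haveI : IsIso (Δ.κ.map (Δ.NtoE.map (ι.app x))) := isIso_map_of_eq₃ Er key
    exact isIso_of_reflects_iso (Δ.NtoE.map (ι.app x)) Δ.κ
  · obtain ⟨hT', hheq⟩ := hc₃ _ _ hT
    have hE : K.E
        ((𝟭q _).mapPath ((((Path.nil : Path (tvNexus T.J) (tvNexus T.J)).cons
          (show tvNexus T.J ⟶ tvThird T.J from LFVertex.lamPfEdge)).comp r)))
        ((𝟭q _).mapPath ((((Path.nil : Path (tvNexus T.J) (tvNexus T.J)).cons
          (show tvNexus T.J ⟶ tvThird T.J from LFVertex.lamTimesEdge)).comp r))) :=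
      K.isSaturated.postcomp hT' r
    have hiso := Δ.isIso_η_of_jfam_compatible T K hJ _ _ hE
    have key := K.isIso_map_of_postcomp_path
      (p := (embLogTele T.J).mapPath ((Path.nil : Path lvNexus.{u} lvNexus).cons eLamPf))
      (q := (embLogTele T.J).mapPath ((Path.nil : Path lvNexus.{u} lvNexus).cons eLamTimes)) r
      (P := fun x => Δ.lamPf.obj x) (Q := fun x => Δ.lamTimes.obj x) (fun x => ι.app x) hT'
      (fun x => (Δ.tele_timesPair_obj x).2) (fun x => (Δ.tele_timesPair_obj x).1)
      (fun x e₁ e₂ => by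
        rw [app_eq_of_heq₃ hFP hFT hheq x, hhT x (Δ.timesPair_obj x).2 (Δ.timesPair_obj x).1]
        exact eqToHom_sandwich₃ _ _ _ _ _)
      hE hiso x
    haveI : IsIso (Δ.κ.map (Δ.NtoE.map (ι.app x))) := isIso_map_of_eq₃ Er key
    exact isIso_of_reflects_iso (Δ.NtoE.map (ι.app x)) Δ.κ

/-- **Necessity (telecore half), `ι_{log,⋎}`**: if `LogObsCompatTelecoreStmt τ` holds, then after `𝒩 → ℰ`
every component of `ι_{log,⋎}` is an ISOMORPHISM of `ℰ` (the type-(1) pair at `⋎ = 0` post-composed with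
`[𝒩 → ℰ]·[κ_An]` is a pair into the core vertex `Anab`).
[cite: MochizukiAbsTopIII2015, Corollary 3.6 (iii) pp.80–81] -/
theorem isIso_NtoE_map_iotaLog_of_logObsCompatTelecoreStmt (τ : Δ.TelecoreData)
    (h : Δ.LogObsCompatTelecoreStmt τ) (x : Δ.X₁) : IsIso (Δ.NtoE.map (Δ.ιlog.app x)) := by
  obtain ⟨H₅, hH₅, hc, T, -, K, hJ, H₃, ⟨-, -, hpin⟩, hc₃⟩ := h
  obtain ⟨-, hlog⟩ := hpin
  obtain ⟨h₁, hh₁⟩ := hlog 0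
  obtain ⟨h₁', hheq⟩ := hc₃ _ _ h₁
  haveI := Δ.κ_equiv
  let r : Path (tvThird T.J) (tvObs T.J) :=
    ((Path.nil : Path (tvThird T.J) (tvThird T.J)).cons
      (show tvThird T.J ⟶ tvFourth T.J from LFVertex.edge34)).cons
      (show tvFourth T.J ⟶ tvObs T.J from (PUnit.unit : coreI5.{u} (vx 4 .fourth (by decide))))
  have Er : (Δ.teleDiagram T.J T.telMap).pathFunctor r = (𝟭 _ ⋙ Δ.NtoE) ⋙ Δ.κ :=
    Δ.tele_pathFunctor_toCore (J := T.J) (telMap := T.telMap)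
  have hFL : Δ.sub3.pathFunctor (logPairLeft.{u} 0) =
      (Δ.teleDiagram T.J T.telMap).pathFunctor ((embLogTele T.J).mapPath (logPairLeft.{u} 0)) :=
    eq_of_heq (Δ.heq_pathFunctor_embLogTele T.J T.telMap _)
  have hFR : Δ.sub3.pathFunctor (logPairRight.{u} 0) =
      (Δ.teleDiagram T.J T.telMap).pathFunctor ((embLogTele T.J).mapPath (logPairRight.{u} 0)) :=
    eq_of_heq (Δ.heq_pathFunctor_embLogTele T.J T.telMap _)
  have hE : K.E
      ((𝟭q _).mapPath ((((((Path.nil : Path (tvRow1 T.J (0 + 1)) (tvRow1 T.J (0 + 1))).cons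
        (show tvRow1 T.J (0 + 1) ⟶ tvRow1 T.J 0 from LFVertex.logEdge 0)).cons
        (show tvRow1 T.J 0 ⟶ tvNexus T.J from LFVertex.idEdge 0)).cons
        (show tvNexus T.J ⟶ tvThird T.J from LFVertex.lamTimesEdge)).comp r)))
      ((𝟭q _).mapPath (((((Path.nil : Path (tvRow1 T.J (0 + 1)) (tvRow1 T.J (0 + 1))).cons
        (show tvRow1 T.J (0 + 1) ⟶ tvNexus T.J from LFVertex.idEdge (0 + 1))).cons
        (show tvNexus T.J ⟶ tvThird T.J from LFVertex.lamPfEdge)).comp r))) :=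
    K.isSaturated.postcomp h₁' r
  have hiso := Δ.isIso_η_of_jfam_compatible T K hJ _ _ hE
  have key := K.isIso_map_of_postcomp_path
    (p := (embLogTele T.J).mapPath (logPairLeft.{u} 0))
    (q := (embLogTele T.J).mapPath (logPairRight.{u} 0)) r
    (P := fun x => Δ.lamTimes.obj (Δ.toNexus.obj (Δ.log.obj x)))
    (Q := fun x => Δ.lamPf.obj (Δ.toNexus.obj x)) (fun x => Δ.ιlog.app x) h₁'
    (fun x => (Δ.tele_logPair_obj 0 x).1) (fun x => (Δ.tele_logPair_obj 0 x).2)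
    (fun x e₁ e₂ => by
      rw [app_eq_of_heq₃ hFL hFR hheq x, hh₁ x (Δ.logPair_obj 0 x).1 (Δ.logPair_obj 0 x).2]
      exact eqToHom_sandwich₃ _ _ _ _ _)
    hE hiso x
  haveI : IsIso (Δ.κ.map (Δ.NtoE.map (Δ.ιlog.app x))) := isIso_map_of_eq₃ Er key
  exact isIso_of_reflects_iso (Δ.NtoE.map (Δ.ιlog.app x)) Δ.κ

/-! ### A datum at which the telecore half fails -/

/-- **The telecore half of the literal clause is NOT a consequence of the typing either**: at the
one-object `(ℕ, +)` datum of `exists_not_logObsCompatCoresStmt` (all functors identities, `ι_× := 1`)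
with the printed-shape telecore datum `⟨𝟭, unitor, unitors⟩`, `LogObsCompatTelecoreStmt` FAILS — the
Galois component `1 ∈ (ℕ, +)` of `ι_×` is not invertible. [cite: MochizukiAbsTopIII2015, Corollary 3.6 (iii) pp.80–81] -/
theorem exists_not_logObsCompatTelecoreStmt :
    ∃ (Δ : LogFrobeniusData.{0}) (τ : Δ.TelecoreData), ¬ Δ.LogObsCompatTelecoreStmt τ := by
  let M : Type := Multiplicative ℕ
  let S : Type := CategoryTheory.SingleObj M
  let ν : 𝟭 S ⟶ 𝟭 S :=
    { app := fun _ => (Multiplicative.ofAdd (1 : ℕ) : M)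
      naturality := fun _ _ f => by
        simp only [Functor.id_obj, Functor.id_map]
        exact mul_comm (Multiplicative.ofAdd (1 : ℕ) : M) (f : M) }
  let Δ : LogFrobeniusData.{0} :=
    { X₁ := S, X := S, toNexus := 𝟭 _, N := S, E := S, A := S,
      log := 𝟭 _, logIsoId := Iso.refl _, lamTimes := 𝟭 _, lamPf := 𝟭 _,
      ιlog := (Functor.rightUnitor (𝟭 S ⋙ 𝟭 S)).hom, ιtimes := Sum.inl ν,
      XtoE := 𝟭 _, NtoE := 𝟭 _, lamTimes_NtoE := Functor.comp_id _, lamPf_NtoE := Functor.comp_id _,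
      κ := 𝟭 _, AtoE := 𝟭 _, κ_equiv := inferInstance, κ_inv := Functor.rightUnitor _,
      φ := 𝟭 _, φ_equiv := inferInstance, η := Functor.rightUnitor _ ≪≫ Functor.rightUnitor _ }
  let τ : Δ.TelecoreData :=
    { φ₁ := 𝟭 _, e := Functor.rightUnitor _,
      η₁ := Functor.rightUnitor _ ≪≫ Functor.rightUnitor _ ≪≫ Functor.rightUnitor _ }
  refine ⟨Δ, τ, fun h => ?_⟩
  have h₁ := Δ.isIso_NtoE_map_iotaTimes_of_logObsCompatTelecoreStmt τ h
  have h₂ : IsIso (ν.app (CategoryTheory.SingleObj.star M)) := h₁ (CategoryTheory.SingleObj.star M)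
  have h₃ : ν.app (CategoryTheory.SingleObj.star M) ≫ inv (ν.app (CategoryTheory.SingleObj.star M)) =
      𝟙 _ := IsIso.hom_inv_id _
  let g : M := inv (ν.app (CategoryTheory.SingleObj.star M))
  have h₄ : g * Multiplicative.ofAdd (1 : ℕ) = (1 : M) := h₃
  have h₅ := congrArg Multiplicative.toAdd h₄
  change Multiplicative.toAdd g + 1 = 0 at h₅
  omega

/-- Hence the universal closure of the telecore half over abstract data (and telecore data) is FALSE.
[cite: MochizukiAbsTopIII2015, Corollary 3.6 (iii) pp.80–81] -/
theorem not_forall_logObsCompatTelecoreStmt :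
    ¬ ∀ (Δ : LogFrobeniusData.{0}) (τ : Δ.TelecoreData), Δ.LogObsCompatTelecoreStmt τ :=
  fun h => exists_not_logObsCompatTelecoreStmt.elim fun Δ hΔ => hΔ.elim fun τ hτ => hτ (h Δ τ)

end LogFrobeniusData

end Literature.AnabelianGeometry.AbsoluteAnabelian
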